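import Summits.AtomisticToContinuum.HydrodynamicLimit.Theses.ImplosionDichotomy
import Summits.AtomisticToContinuum.HydrodynamicLimit.Theorems.HydroLimitProfilewiseBand.Negative.Structure
import Summits.AtomisticToContinuum.HydrodynamicLimit.Theorems.HydroLimitInBand.Negative.VacuousRegime
import HarnessLib

/-!
# `HydroLimitProfilewiseBand` (crux stmt-AtomisticToContinuum-17372), negative side: the `∀∃` shape is STRICTLY weaker
# than the `∃∀` shape over a solution class — SHAPE SEPARATION

Standing crux disprover `refuter-cdisprove-stmt-AtomisticToContinuum-17372-0`, cycle 1 (2026-08-17), `Disproof.lean` §6(i).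

The crux `HydroLimitProfilewiseBand = ProfilewiseFor IsHardSphereEulerSolution` (`∀ profiles ∃ η …`) is implied by the
sibling / Statement `HydroLimitInBand = InBandFor IsHardSphereEulerSolution` (`∃ η₀ ∀ profiles …`) for EVERY solution class
(`profilewiseFor_of_inBandFor`).  Is the converse formal — could `hP : HydroLimitProfilewiseBand` be upgraded to the
Statement WITHOUT the route's other `closes` hypothesis `hD : DiluteSelfConsistency`?  This file answers NO at the level of
solution classes: there is a class `ToySol` (same tie, guard, flows and local Gibbs laws as the crux; only the PDE is
replaced) with `ProfilewiseFor ToySol` TRUE and `InBandFor ToySol` FALSE (`shape_separation`).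

The class: for `k ≥ 1` and every `σ`, the fields on `[0, 1)` with equilibrium data `(1, 0, k)` (temperature `k`) whose
density jumps at `t = 1/2` to the constant `(kσ³)⁻¹` — packing EXACTLY `1/k` from then on (a "dense excursion" whose depth
is set by the temperature of the data).
* `profilewiseFor_toySol`: given profiles `(a₀, θ₀, u₀)` take the cap `η := (θ₀(0) + 1)⁻¹` and the statics threshold;
  a member tied at `t = 0` has its data PINNED (`admissible_iff_data`), so `θ₀ ≡ k` and the cap is `(k+1)⁻¹ < 1/k`:
  the guard excludes every tied member — the profile-wise statement holds (vacuously in its dynamic part).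
* `not_inBandFor_toySol`: given a uniform cap `η₀` choose `k > 1/η₀` and THEN the profile `(1, 0, k)`: the member has
  packing `max(σ³, 1/k) < η₀`, is tied (equilibrium package at temperature `k`), and at `t = 1/2` its density `(kσ³)⁻¹ ≠ 1`
  contradicts equilibrium rigidity.
Reading: the upgrade `∀∃ ⇒ ∃∀` needs PACKING CONTROL ALONG SOLUTIONS uniformly in the profile — precisely what
`DiluteSelfConsistency` supplies in `closes` (cf. `Census.profilewise_iff_inBand_of_dilute`); `ToySol` is a class for which
the analogue of `DiluteSelfConsistency` fails (hot data compress to packing `1/k` at every `σ`), and for it the two shapes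
differ.  So `hD` is load-bearing in `closes` at the shape level, and no proof of `HydroLimitProfilewiseBand → HydroLimitInBand`
can avoid the specific PDE content of `IsHardSphereEulerSolution`.
-/

noncomputable section

open MeasureTheory Filter Set Topology
open scoped ENNReal

namespace Summit.AtomisticToContinuum.HydrodynamicLimit.Theorems

open Literature.MathematicalPhysics.KineticTheory Literature.Analysis.FluidPDE
open Summit.AtomisticToContinuum.HydrodynamicLimit.Theses.ImplosionDichotomy (HydroLimitProfilewiseBand HydroLimitInBand)
open PolynomialCompressionPDE (Flows flows_nonempty admissible_iff_data)
open HydroLimitInBandNegative (SolClass InBandFor equilibrium_package exists_sigma_small)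

namespace HydroLimitProfilewiseBandNegative

/-! ## §1 The toy solution class -/

/-- Density of the toy member: `1` before `t = 1/2`, the constant `(k σ³)⁻¹` (packing exactly `1/k`) from `t = 1/2` on. -/
def spikeDensity (k : ℕ) (σ : ℝ) : ℝ → T3 → ℝ := fun t _ => if t < 1 / 2 then 1 else ((k : ℝ) * σ ^ 3)⁻¹

/-- **The toy class**: members indexed by `k ≥ 1` — on `[0, 1)`, velocity `0`, temperature `k`, density `spikeDensity k σ`
(equilibrium data `(1, 0, k)`; compression to packing `1/k` at `t = 1/2`). No PDE is imposed. -/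
def ToySol : SolClass := fun σ T ρ u θ =>
  ∃ k : ℕ, 1 ≤ k ∧ T = 1 ∧ ρ = spikeDensity k σ ∧ u = (fun _ _ => (0 : V3)) ∧ θ = (fun _ _ => (k : ℝ))

/-- The time-`0` slice of the toy density is the constant `1`. [folklore] -/
theorem spikeDensity_zero (k : ℕ) (σ : ℝ) : spikeDensity k σ 0 = fun _ => 1 := by
  funext x
  norm_num [spikeDensity]

/-- After `t = 1/2` the toy member has packing exactly `1/k` (for `σ ≠ 0`). [folklore] -/
theorem spikeDensity_mul_cube {k : ℕ} {σ : ℝ} (hσ : σ ≠ 0) {t : ℝ} (ht : 1 / 2 ≤ t) (x : T3) :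
    spikeDensity k σ t x * σ ^ 3 = (k : ℝ)⁻¹ := by
  have h : ¬ t < 1 / 2 := not_lt.2 ht
  simp only [spikeDensity, h, if_false]
  rw [mul_inv, inv_mul_cancel_right₀ (pow_ne_zero 3 hσ)]

/-! ## §2 The profile-wise shape HOLDS for the toy class -/

/-- **`ProfilewiseFor ToySol`.** Cap `η := (θ₀(0) + 1)⁻¹`, threshold = the statics threshold of data pinning: a member tied
at `t = 0` has `θ₀ ≡ k` (pinning), and then its packing `1/k` at `t = 1/2` violates the cap `(k+1)⁻¹` — the guard excludes
every tied member. [folklore] -/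
theorem profilewiseFor_toySol : ProfilewiseFor ToySol := by
  intro a₀ θ₀ u₀ ha hθ hu ha0 hθ0
  obtain ⟨σ₁, hσ₁, -, A⟩ := admissible_iff_data ha hθ hu ha0 hθ0
  have hθ00 : 0 < θ₀ 0 := hθ0 0
  refine ⟨(θ₀ 0 + 1)⁻¹, inv_pos.2 (by linarith), σ₁, hσ₁,
    fun σ hσ hσlt T ρ θ u hSol hguard Φ h0 t ht => ?_⟩
  exfalso
  obtain ⟨k, hk1, rfl, rfl, rfl, rfl⟩ := hSol
  obtain ⟨-, A'⟩ := A σ hσ hσlt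
  have hρc : Continuous (spikeDensity k σ 0) := by
    rw [spikeDensity_zero]
    exact continuous_const
  obtain ⟨-, -, hθeq⟩ := (A' (spikeDensity k σ) (fun _ _ => (k : ℝ)) (fun _ _ => (0 : V3)) hρc continuous_const
    continuous_const).1 fun Ψ => DenseExcursionDichotomy.tendstoHydroFieldsAt_zero_transfer Φ Ψ h0
  have hk : θ₀ 0 = k := (congrFun hθeq 0).symm
  have hg := hguard (1 / 2) ⟨by norm_num, by norm_num⟩ (0 : T3)
  rw [spikeDensity_mul_cube hσ.ne' le_rfl, hk] at hg
  have hkpos : (0 : ℝ) < k := by exact_mod_cast hk1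
  have hlt : ((k : ℝ) + 1)⁻¹ < (k : ℝ)⁻¹ := by
    rw [inv_lt_inv₀ (by linarith) hkpos]
    linarith
  linarith

/-! ## §3 The uniform shape FAILS for the toy class -/

/-- **`¬ InBandFor ToySol`.** Given a uniform cap `η₀`, choose `k > 1/η₀` and then the homogeneous profile `(1, 0, k)`;
for `σ` below the equilibrium-package threshold with `2σ³ < min η₀ (1/k)`, the member `k` has packing `< η₀` on `[0,1)`,
is tied at `t = 0`, and the uniform statement would make the temperature-`k` Gibbs law follow it at `t = 1/2`, where its
density `(kσ³)⁻¹ ≥ 2 ≠ 1` contradicts equilibrium rigidity. [folklore] -/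
theorem not_inBandFor_toySol : ¬ InBandFor ToySol := by
  rintro ⟨η₀, hη₀, H⟩
  obtain ⟨k, hk⟩ := exists_nat_gt η₀⁻¹
  have hkpos : (0 : ℝ) < k := (inv_pos.2 hη₀).trans hk
  have hk1 : 1 ≤ k := Nat.one_le_iff_ne_zero.2 (by rintro rfl; simp at hkpos)
  have hkη : (k : ℝ)⁻¹ < η₀ := (inv_lt_comm₀ hkpos hη₀).2 hk
  obtain ⟨σ₀, hσ₀, G⟩ := H (fun _ => 1) (fun _ => (k : ℝ)) (fun _ => 0) continuous_const continuous_const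
    continuous_const (fun _ => one_pos) (fun _ => hkpos)
  obtain ⟨σ₁, hσ₁, hσ₁2, P⟩ := equilibrium_package (a := 1) (θc := (k : ℝ)) (0 : V3) one_pos hkpos
  obtain ⟨σ, hσ, hσlt, hσcube⟩ :=
    exists_sigma_small (min η₀ (k : ℝ)⁻¹) (min σ₀ σ₁) (lt_min hη₀ (inv_pos.2 hkpos)) (lt_min hσ₀ hσ₁)
  have hσ₀' : σ < σ₀ := lt_of_lt_of_le hσlt (min_le_left _ _)
  have hσ₁' : σ < σ₁ := lt_of_lt_of_le hσlt (min_le_right _ _)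
  have hσ3 : 0 < σ ^ 3 := pow_pos hσ 3
  have hcη : 2 * σ ^ 3 < η₀ := hσcube.trans_le (min_le_left _ _)
  have hck : 2 * σ ^ 3 < (k : ℝ)⁻¹ := hσcube.trans_le (min_le_right _ _)
  obtain ⟨Φ⟩ := flows_nonempty hσ (hσ₁'.trans_le hσ₁2)
  obtain ⟨-, htie, hrig⟩ := P σ hσ hσ₁' Φ
  have hSol : ToySol σ 1 (spikeDensity k σ) (fun _ _ => (0 : V3)) (fun _ _ => (k : ℝ)) :=
    ⟨k, hk1, rfl, rfl, rfl, rfl⟩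
  have hguard : ∀ t ∈ Ico (0 : ℝ) 1, ∀ x : T3, spikeDensity k σ t x * σ ^ 3 < η₀ := by
    intro t _ x
    by_cases h : t < 1 / 2
    · simp only [spikeDensity, h, if_true, one_mul]
      linarith
    · rw [spikeDensity_mul_cube hσ.ne' (not_lt.1 h) x]
      exact hkη
  have h0 := htie (spikeDensity k σ) (fun _ _ => (k : ℝ)) (fun _ _ => (0 : V3)) (spikeDensity_zero k σ) rfl rfl
  have hT := G σ hσ hσ₀' 1 _ _ _ hSol hguard Φ h0 (1 / 2) ⟨by norm_num, by norm_num⟩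
  have hρc : Continuous (spikeDensity k σ (1 / 2)) := by
    have : spikeDensity k σ (1 / 2) = fun _ => ((k : ℝ) * σ ^ 3)⁻¹ := by
      funext x
      simp [spikeDensity]
    rw [this]
    exact continuous_const
  obtain ⟨hρ, -, -⟩ := hrig _ _ _ (1 / 2) hρc continuous_const continuous_const hT
  have h1 := congrFun hρ (0 : T3)
  have h2 : spikeDensity k σ (1 / 2) (0 : T3) * σ ^ 3 = (k : ℝ)⁻¹ := spikeDensity_mul_cube hσ.ne' le_rfl 0
  rw [h1, one_mul] at h2
  -- `σ³ = 1/k` contradicts `2σ³ < 1/k`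
  linarith

/-! ## §4 Shape separation -/

/-- **SHAPE SEPARATION.** There is a solution class for which the PROFILE-WISE guarded LLN transfer holds and the UNIFORM
one fails: `ProfilewiseFor Sol → InBandFor Sol` is not formal, i.e. no proof of `HydroLimitProfilewiseBand → HydroLimitInBand`
(the converse of the route's support `ProfilewiseOfInBand`) can be generic in the solution class — it must use packing control
along classical solutions, which is what `DiluteSelfConsistency` contributes to `closes`. [folklore] -/
theorem shape_separation : ∃ Sol : SolClass, ProfilewiseFor Sol ∧ ¬ InBandFor Sol :=
  ⟨ToySol, profilewiseFor_toySol, not_inBandFor_toySol⟩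

/-- Corollary: the generic upgrade principle is false. [folklore] -/
theorem not_forall_inBandFor_of_profilewiseFor : ¬ ∀ Sol : SolClass, ProfilewiseFor Sol → InBandFor Sol :=
  fun h => not_inBandFor_toySol (h ToySol profilewiseFor_toySol)

end HydroLimitProfilewiseBandNegative

end Summit.AtomisticToContinuum.HydrodynamicLimit.Theorems

end
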